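import Summits.NavierStokesRegularity.NavierStokesRegularity.Theorems.AxisymmetricExtremalityAxisymmetricKatoGlobalStubSeregin2020TypeIILemma22ExcisionErrorTools
import HarnessLib

/-!
# Seregin 2020, Lemma 2.2 (after Nazarov–Uraltseva 2012), piece L22-B (the energy class across the
# axis), step F3b.4 (e3): the AXIS-DRIFT excision error

Helper toward the stub `stub_seregin2020TypeII` of the crux `AxisymmetricKatoGlobal` (Seregin 2020,
Thm 2.1 ⇐ Lemma 2.2 = N–U 2012 Lemma 4.2 in the class 𝒱), piece L22-B (route P, kit `A1-L22B-F3`,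
texts of record of 2026-08-28): with the test function `Θ ∏_{i∈A}(1-ψᵢ)` (active balls
`B(xᵢ,4rᵢ)` excised) the product rule `fderiv_cutoffProduct_sq_apply` leaves the error integrand
`η (2/ϱ) H(Φ) Θ² D(∏(1-ψᵢ))²·e_ϱ`; `excision_axisError_le` proves it integrable on a time step
`[a,b] × ℝ³` with `L¹` norm `≤ K (b - a) Σ_{i∈A} rᵢ`, `K` depending on the fixed data only
(`∫_{B(xᵢ,4rᵢ)} ϱ⁻¹ ≤ C rᵢ²` for any centre). Summed over the steps of the excision schedule (ball `i`
active for total time `≤ 4rᵢ²`) the total axis error is `≤ 4K Σ rᵢ³ → 0`.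
No Navier–Stokes statement is proved here.

## References

* A. I. Nazarov, N. N. Uraltseva, St. Petersburg Math. J. 23 (2012) 93–115 = arXiv:1011.1888,
  §4, Lemma 4.2 (the class with the singular drift `2x'/|x'|²`). [NazarovUraltseva2012]
* G. Seregin, Anal. Math. Phys. 10 (2020) 46 = arXiv:2006.04140, Lemma 2.2, class 𝒱 (the set `S`
  of parabolic Hausdorff dimension `≤ 1` on the axis). [Seregin2020]
-/

-- the problem directory repeats the summit name (D-0017); core's `dupNamespace` linter fires
set_option linter.dupNamespace false

noncomputable section

open MeasureTheory Set Function Filter Topology TopologicalSpace Metric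
open scoped NNReal ENNReal InnerProductSpace

namespace Summit.NavierStokesRegularity.NavierStokesRegularity.Theorems.AxisymmetricKatoGlobal.EulerScaling

open Literature.Analysis.FluidPDE Literature.Analysis.FluidPDE.Seregin2020

/-! ### (e3) the axis-drift excision error -/

set_option maxHeartbeats 800000 in
/-- **(e3) The axis-drift excision error.** Fix the data `Φ ≥ 0` (jointly measurable), a `C²`
profile `H ≥ 0` with `H' ≤ 0`, a `C¹` compactly supported `Θ`, a `C¹` time weight `η`, a window
`[t₁, t₂]` and a gradient constant `C₀ ≥ 0`. There is `K ≥ 0` such that for every finite family of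
`C¹` bumps `ψᵢ ∈ [0,1]` with `‖Dψᵢ‖ ≤ C₀/rᵢ`, `Dψᵢ = 0` off `B(xᵢ, 4rᵢ)` (`i ∈ A`), and every step
`[a, b] ⊆ [t₁, t₂]`, the error integrand
`η (2/ϱ) H(Φ) Θ² D(∏_{i∈A}(1-ψᵢ))²·e_ϱ` is integrable on `[a,b] × ℝ³` with
`∫∫ |η (2/ϱ) H(Φ) Θ² D(∏(1-ψᵢ))²·e_ϱ| ≤ K (b - a) Σ_{i∈A} rᵢ`
(`|D(∏(1-ψᵢ))²| ≤ 2Σ (C₀/rᵢ) 1_{B(xᵢ,4rᵢ)}` and `∫_{B(xᵢ,4rᵢ)} ϱ⁻¹ ≤ C rᵢ²`). Step F3b.4 (e3) of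
the passage of the energy class across the axis set `S`; summed over the steps with "ball `i`
active for total time `≤ 4rᵢ²`" it is `≤ 4K Σ rᵢ³ → 0`.
[cite: NazarovUraltseva2012, §4, proof of Lemma 4.2 (the singular drift term); Seregin2020, Lemma 2.2] -/
theorem excision_axisError_le
    {Φ : ℝ → EuclideanSpace ℝ (Fin 3) → ℝ}
    {H : ℝ → ℝ} {Θ : EuclideanSpace ℝ (Fin 3) → ℝ} {η : ℝ → ℝ} {t₁ t₂ C₀ : ℝ}
    (hΦm : Measurable (uncurry Φ)) (hΦ0 : ∀ t x, 0 ≤ Φ t x)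
    (hH : ContDiff ℝ 2 H) (hH' : ∀ v, deriv H v ≤ 0) (hH0 : ∀ v, 0 ≤ H v)
    (hΘ : ContDiff ℝ 1 Θ) (hΘc : HasCompactSupport Θ)
    (hη : ContDiff ℝ 1 η) (hC₀ : 0 ≤ C₀) :
    ∃ K : ℝ, 0 ≤ K ∧ ∀ (A : Finset ℕ) (x : ℕ → EuclideanSpace ℝ (Fin 3)) (r : ℕ → ℝ)
      (ψ : ℕ → EuclideanSpace ℝ (Fin 3) → ℝ) (a b : ℝ), t₁ ≤ a → a ≤ b → b ≤ t₂ →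
      (∀ i ∈ A, 0 < r i) → (∀ i ∈ A, ContDiff ℝ 1 (ψ i)) → (∀ i ∈ A, ∀ y, 0 ≤ ψ i y ∧ ψ i y ≤ 1) →
      (∀ i ∈ A, ∀ y, ‖fderiv ℝ (ψ i) y‖ ≤ C₀ / r i) →
      (∀ i ∈ A, ∀ y, y ∉ ball (x i) (4 * r i) → fderiv ℝ (ψ i) y = 0) →
      IntegrableOn (fun z : ℝ × EuclideanSpace ℝ (Fin 3) => η z.1 * (2 / cylRadius z.2 *
          (H (Φ z.1 z.2) * (Θ z.2 ^ 2 *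
            fderiv ℝ (fun y => (∏ i ∈ A, (1 - ψ i y)) ^ 2) z.2 (eR z.2)))))
        (Icc a b ×ˢ univ) volume ∧
      ∫ z in Icc a b ×ˢ (univ : Set (EuclideanSpace ℝ (Fin 3))), |η z.1 * (2 / cylRadius z.2 *
          (H (Φ z.1 z.2) * (Θ z.2 ^ 2 *
            fderiv ℝ (fun y => (∏ i ∈ A, (1 - ψ i y)) ^ 2) z.2 (eR z.2))))|
        ≤ K * (b - a) * ∑ i ∈ A, r i := by
  classical
  obtain ⟨C, hC⟩ := lintegral_inv_cylRadius_ballStep_le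
  -- bounds of the fixed data
  obtain ⟨Mη, hMη0, hMη⟩ : ∃ M : ℝ, 0 ≤ M ∧ ∀ t ∈ Icc t₁ t₂, |η t| ≤ M := by
    obtain ⟨M, hM⟩ := isCompact_Icc.exists_bound_of_continuousOn
      (hη.continuous.continuousOn (s := Icc t₁ t₂))
    refine ⟨max M 0, le_max_right _ _, fun t ht => ?_⟩
    exact ((Real.norm_eq_abs _).symm.le.trans (hM t ht)).trans (le_max_left _ _)
  obtain ⟨CΘ, hCΘ0, hCΘ⟩ : ∃ C : ℝ, 0 ≤ C ∧ ∀ y, |Θ y| ≤ C := by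
    obtain ⟨C, hC⟩ := hΘ.continuous.bounded_above_of_compact_support hΘc
    refine ⟨max C 0, le_max_right _ _, fun y => ?_⟩
    exact ((Real.norm_eq_abs _).symm.le.trans (hC y)).trans (le_max_left _ _)
  have hHanti : Antitone H := antitone_of_deriv_nonpos (hH.differentiable two_ne_zero) hH'
  have hHle : ∀ t y, H (Φ t y) ≤ H 0 := fun t y => hHanti (hΦ0 t y)
  have hH00 : 0 ≤ H 0 := hH0 0
  refine ⟨64 * Mη * H 0 * CΘ ^ 2 * C * C₀, by positivity, ?_⟩
  intro A x r ψ a b hta hab hbt hr hψ h01 hD hD0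
  have hSm : MeasurableSet (Icc a b ×ˢ (univ : Set (EuclideanSpace ℝ (Fin 3)))) :=
    measurableSet_Icc.prod MeasurableSet.univ
  have hPsq : ContDiff ℝ 1 (fun y => (∏ i ∈ A, (1 - ψ i y)) ^ 2) := (contDiff_prodCut hψ).pow 2
  have hDer := abs_fderiv_prodCut_sq_eR_le hψ h01 hD hD0
  have hρm : Measurable (fun z : ℝ × EuclideanSpace ℝ (Fin 3) => (cylRadius z.2)⁻¹) :=
    (continuous_cylRadius.measurable.comp measurable_snd).inv
  have hBm : ∀ i, MeasurableSet ((univ : Set ℝ) ×ˢ ball (x i) (4 * r i)) :=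
    fun i => MeasurableSet.univ.prod measurableSet_ball
  -- ### the indicator terms of the majorant: integrability on the step and their integrals
  have hterm : ∀ i ∈ A,
      IntegrableOn (((univ : Set ℝ) ×ˢ ball (x i) (4 * r i)).indicator
        fun z : ℝ × EuclideanSpace ℝ (Fin 3) => (cylRadius z.2)⁻¹) (Icc a b ×ˢ univ) volume ∧
      ∫ z in Icc a b ×ˢ (univ : Set (EuclideanSpace ℝ (Fin 3))),
          ((univ : Set ℝ) ×ˢ ball (x i) (4 * r i)).indicator
            (fun z : ℝ × EuclideanSpace ℝ (Fin 3) => (cylRadius z.2)⁻¹) z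
        ≤ (C : ℝ) * ((b - a) * (4 * r i) ^ 2) := by
    intro i hi
    have hri : 0 < 4 * r i := by linarith [hr i hi]
    have hset : ((univ : Set ℝ) ×ˢ ball (x i) (4 * r i)) ∩
        (Icc a b ×ˢ (univ : Set (EuclideanSpace ℝ (Fin 3)))) = Icc a b ×ˢ ball (x i) (4 * r i) := by
      rw [prod_inter_prod, univ_inter, inter_univ]
    have hset' : (Icc a b ×ˢ (univ : Set (EuclideanSpace ℝ (Fin 3)))) ∩
        ((univ : Set ℝ) ×ˢ ball (x i) (4 * r i)) = Icc a b ×ˢ ball (x i) (4 * r i) := by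
      rw [prod_inter_prod, inter_univ, univ_inter]
    have hlin := hC a b (x i) (4 * r i) hab hri
    have hlt : ∫⁻ z in Icc a b ×ˢ ball (x i) (4 * r i), ENNReal.ofReal ((cylRadius z.2)⁻¹) < ⊤ :=
      lt_of_le_of_lt hlin (ENNReal.mul_lt_top ENNReal.coe_lt_top ENNReal.ofReal_lt_top)
    have hint : IntegrableOn (fun z : ℝ × EuclideanSpace ℝ (Fin 3) => (cylRadius z.2)⁻¹)
        (Icc a b ×ˢ ball (x i) (4 * r i)) volume := by
      refine ⟨hρm.aestronglyMeasurable, ?_⟩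
      rw [hasFiniteIntegral_iff_enorm]
      refine lt_of_le_of_lt (le_of_eq ?_) hlt
      refine lintegral_congr_ae (ae_of_all _ fun z => ?_)
      dsimp only
      rw [Real.enorm_eq_ofReal (inv_nonneg.2 (cylRadius_nonneg _))]
    refine ⟨(integrableOn_indicator_iff (hBm i)).2 (by rwa [hset]), ?_⟩
    rw [setIntegral_indicator (hBm i), hset',
      integral_eq_lintegral_of_nonneg_ae (ae_of_all _ fun z => inv_nonneg.2 (cylRadius_nonneg _))
        hρm.aestronglyMeasurable]
    have := ENNReal.toReal_mono (ENNReal.mul_lt_top ENNReal.coe_lt_top ENNReal.ofReal_lt_top).ne hlin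
    rwa [ENNReal.toReal_mul, ENNReal.coe_toReal,
      ENNReal.toReal_ofReal (mul_nonneg (sub_nonneg.2 hab) (sq_nonneg _))] at this
  -- ### the majorant `G = Σ_i c_i 1_{ℝ×B_i} ϱ⁻¹`
  obtain ⟨c, hc⟩ : ∃ c : ℕ → ℝ, c = fun i => 4 * Mη * H 0 * CΘ ^ 2 * (C₀ / r i) := ⟨_, rfl⟩
  have hc0 : ∀ i ∈ A, 0 ≤ c i := by
    intro i hi; rw [hc]; have := hr i hi; positivity
  have hGint : Integrable (fun z : ℝ × EuclideanSpace ℝ (Fin 3) => ∑ i ∈ A, c i *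
      ((univ : Set ℝ) ×ˢ ball (x i) (4 * r i)).indicator
        (fun z : ℝ × EuclideanSpace ℝ (Fin 3) => (cylRadius z.2)⁻¹) z)
      (volume.restrict (Icc a b ×ˢ univ)) :=
    integrable_finsetSum _ fun i hi => (hterm i hi).1.const_mul (c i)
  -- ### the pointwise bound on the step
  have hbound : ∀ z : ℝ × EuclideanSpace ℝ (Fin 3), z.1 ∈ Icc a b →
      |η z.1 * (2 / cylRadius z.2 * (H (Φ z.1 z.2) * (Θ z.2 ^ 2 *
          fderiv ℝ (fun y => (∏ i ∈ A, (1 - ψ i y)) ^ 2) z.2 (eR z.2))))| ≤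
        ∑ i ∈ A, c i * ((univ : Set ℝ) ×ˢ ball (x i) (4 * r i)).indicator
          (fun z : ℝ × EuclideanSpace ℝ (Fin 3) => (cylRadius z.2)⁻¹) z := by
    intro z hz
    have hηz : |η z.1| ≤ Mη := hMη z.1 ⟨hta.trans hz.1, hz.2.trans hbt⟩
    have hρ0 : 0 ≤ (cylRadius z.2)⁻¹ := inv_nonneg.2 (cylRadius_nonneg _)
    have h2ρ : |2 / cylRadius z.2| = 2 * (cylRadius z.2)⁻¹ := by
      rw [div_eq_mul_inv, abs_of_nonneg (mul_nonneg zero_le_two hρ0)]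
    have hHz : |H (Φ z.1 z.2)| ≤ H 0 := by rw [abs_of_nonneg (hH0 _)]; exact hHle _ _
    have hΘz : |Θ z.2 ^ 2| ≤ CΘ ^ 2 := by
      rw [abs_pow]; exact pow_le_pow_left₀ (abs_nonneg _) (hCΘ _) 2
    have hDz := hDer z.2
    have hind : ∀ i, (ball (x i) (4 * r i)).indicator (fun _ => (1 : ℝ)) z.2 * (cylRadius z.2)⁻¹ =
        ((univ : Set ℝ) ×ˢ ball (x i) (4 * r i)).indicator
          (fun z : ℝ × EuclideanSpace ℝ (Fin 3) => (cylRadius z.2)⁻¹) z := by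
      intro i
      by_cases h : z.2 ∈ ball (x i) (4 * r i)
      · rw [indicator_of_mem h, indicator_of_mem (show z ∈ (univ : Set ℝ) ×ˢ ball (x i) (4 * r i)
          from ⟨mem_univ _, h⟩), one_mul]
      · rw [indicator_of_notMem h, indicator_of_notMem (show z ∉ (univ : Set ℝ) ×ˢ ball (x i) (4 * r i)
          from fun hz' => h hz'.2), zero_mul]
    rw [abs_mul, abs_mul, abs_mul, abs_mul, h2ρ]
    calc |η z.1| * (2 * (cylRadius z.2)⁻¹ * (|H (Φ z.1 z.2)| * (|Θ z.2 ^ 2| *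
          |fderiv ℝ (fun y => (∏ i ∈ A, (1 - ψ i y)) ^ 2) z.2 (eR z.2)|)))
        ≤ Mη * (2 * (cylRadius z.2)⁻¹ * (H 0 * (CΘ ^ 2 *
            (2 * ∑ i ∈ A, C₀ / r i * (ball (x i) (4 * r i)).indicator (fun _ => (1 : ℝ)) z.2)))) := by
          refine mul_le_mul hηz (mul_le_mul_of_nonneg_left (mul_le_mul hHz
            (mul_le_mul hΘz hDz (abs_nonneg _) (sq_nonneg _)) (by positivity) hH00)
            (mul_nonneg zero_le_two hρ0)) (by positivity) hMη0
      _ = ∑ i ∈ A, c i * ((univ : Set ℝ) ×ˢ ball (x i) (4 * r i)).indicator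
            (fun z : ℝ × EuclideanSpace ℝ (Fin 3) => (cylRadius z.2)⁻¹) z := by
          rw [show Mη * (2 * (cylRadius z.2)⁻¹ * (H 0 * (CΘ ^ 2 *
              (2 * ∑ i ∈ A, C₀ / r i * (ball (x i) (4 * r i)).indicator (fun _ => (1 : ℝ)) z.2)))) =
              (4 * Mη * H 0 * CΘ ^ 2 * (cylRadius z.2)⁻¹) *
                ∑ i ∈ A, C₀ / r i * (ball (x i) (4 * r i)).indicator (fun _ => (1 : ℝ)) z.2 by ring,
            Finset.mul_sum]
          refine Finset.sum_congr rfl fun i _ => ?_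
          rw [← hind i, hc]
          ring
  -- ### measurability of the integrand
  have hfm : AEStronglyMeasurable (fun z : ℝ × EuclideanSpace ℝ (Fin 3) => η z.1 * (2 / cylRadius z.2 *
      (H (Φ z.1 z.2) * (Θ z.2 ^ 2 *
        fderiv ℝ (fun y => (∏ i ∈ A, (1 - ψ i y)) ^ 2) z.2 (eR z.2)))))
      (volume.restrict (Icc a b ×ˢ univ)) := by
    have h1 : Measurable fun z : ℝ × EuclideanSpace ℝ (Fin 3) => η z.1 :=
      (hη.continuous.comp continuous_fst).measurable
    have h2 : Measurable fun z : ℝ × EuclideanSpace ℝ (Fin 3) => 2 / cylRadius z.2 :=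
      measurable_const.div (continuous_cylRadius.comp continuous_snd).measurable
    have h3 : Measurable fun z : ℝ × EuclideanSpace ℝ (Fin 3) => H (Φ z.1 z.2) :=
      hH.continuous.measurable.comp hΦm
    have h4 : Measurable fun z : ℝ × EuclideanSpace ℝ (Fin 3) => Θ z.2 ^ 2 :=
      ((hΘ.continuous.comp continuous_snd).pow 2).measurable
    have h5 : Measurable fun z : ℝ × EuclideanSpace ℝ (Fin 3) =>
        fderiv ℝ (fun y => (∏ i ∈ A, (1 - ψ i y)) ^ 2) z.2 (eR z.2) := by
      have hg : Continuous (gradient (fun y => (∏ i ∈ A, (1 - ψ i y)) ^ 2)) :=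
        (InnerProductSpace.toDual ℝ (EuclideanSpace ℝ (Fin 3))).symm.continuous.comp
          (hPsq.continuous_fderiv one_ne_zero)
      have e : (fun z : ℝ × EuclideanSpace ℝ (Fin 3) =>
          fderiv ℝ (fun y => (∏ i ∈ A, (1 - ψ i y)) ^ 2) z.2 (eR z.2)) =
          fun z => ⟪gradient (fun y => (∏ i ∈ A, (1 - ψ i y)) ^ 2) z.2, eR z.2⟫_ℝ := by
        funext z; rw [gradient, InnerProductSpace.toDual_symm_apply]
      rw [e]
      exact (hg.measurable.comp measurable_snd).inner (measurable_eR.comp measurable_snd)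
    exact (h1.mul (h2.mul (h3.mul (h4.mul h5)))).aestronglyMeasurable
  -- ### assembly
  refine ⟨Integrable.mono' hGint hfm ((ae_restrict_mem hSm).mono fun z hz => ?_), ?_⟩
  · rw [Real.norm_eq_abs]; exact hbound z hz.1
  · calc ∫ z in Icc a b ×ˢ (univ : Set (EuclideanSpace ℝ (Fin 3))), |η z.1 * (2 / cylRadius z.2 *
            (H (Φ z.1 z.2) * (Θ z.2 ^ 2 *
              fderiv ℝ (fun y => (∏ i ∈ A, (1 - ψ i y)) ^ 2) z.2 (eR z.2))))|
        ≤ ∫ z in Icc a b ×ˢ (univ : Set (EuclideanSpace ℝ (Fin 3))), ∑ i ∈ A, c i *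
            ((univ : Set ℝ) ×ˢ ball (x i) (4 * r i)).indicator
              (fun z : ℝ × EuclideanSpace ℝ (Fin 3) => (cylRadius z.2)⁻¹) z :=
          integral_mono_of_nonneg (ae_of_all _ fun z => abs_nonneg _) hGint
            ((ae_restrict_mem hSm).mono fun z hz => hbound z hz.1)
      _ = ∑ i ∈ A, c i * ∫ z in Icc a b ×ˢ (univ : Set (EuclideanSpace ℝ (Fin 3))),
            ((univ : Set ℝ) ×ˢ ball (x i) (4 * r i)).indicator
              (fun z : ℝ × EuclideanSpace ℝ (Fin 3) => (cylRadius z.2)⁻¹) z := by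
          rw [integral_finsetSum _ fun i hi => (hterm i hi).1.const_mul (c i)]
          refine Finset.sum_congr rfl fun i _ => ?_
          exact integral_const_mul _ _
      _ ≤ ∑ i ∈ A, c i * ((C : ℝ) * ((b - a) * (4 * r i) ^ 2)) :=
          Finset.sum_le_sum fun i hi => mul_le_mul_of_nonneg_left (hterm i hi).2 (hc0 i hi)
      _ = 64 * Mη * H 0 * CΘ ^ 2 * C * C₀ * (b - a) * ∑ i ∈ A, r i := by
          rw [Finset.mul_sum]
          refine Finset.sum_congr rfl fun i hi => ?_
          have hri : r i ≠ 0 := (hr i hi).ne'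
          rw [hc]
          field_simp
          ring

end Summit.NavierStokesRegularity.NavierStokesRegularity.Theorems.AxisymmetricKatoGlobal.EulerScaling

end
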